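import Summits.NavierStokesRegularity.NavierStokesRegularity.Theorems.TypeICertificateLadderTargetOscillationRung
import HarnessLib

/-!
# Crux `Target` = `TypeICertificateLadder.NoTypeIBlowup` (stmt-NavierStokesRegularity-1217), line
# `depletion-ladder`: THE MOST-TIMES RUNG — a Type-I blow-up spends a definite LOGARITHMIC fraction
# of its last moments above every sub-threshold rate

`--supports stmt-NavierStokesRegularity-1217` (corollary of the log-integral rung
`hasSmoothExtensionPast_of_logIntegral_oscillation`, in the most-times language of the route's
deciding crux W3ᵐᵗ stmt-19551).

* `hasSmoothExtensionPast_of_twoLevelRate` — **THE MOST-TIMES (TWO-LEVEL) RUNG.** Let `u` be a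
  classical solution of the unforced Navier–Stokes system on `ℝ³ × [0,T)`, Leray–Hopf from its rapidly
  decaying datum. Suppose that from some time `t₁ < T` on, the Galilean rate
  `√(T−t)·inf_c sup_x |u(t,x) − c|/√ν` is at most `C₂` at every time and at most `C₁ ≤ C₂` outside an
  exceptional time set `E` (any set) whose LOGARITHMIC final density is at most `θ`:
  `∫_{E ∩ (0,t)} ds/(T−s) ≤ B' + θ·log(T/(T−t))` for `t ∈ (0,T)`. If
  `((2+√3)/9)² · (C₁² + θ (C₂² − C₁²)) < 1` then `u` extends smoothly past `T`.
  (Linear final density `|E ∩ (T−h,T)| ≤ θh`, the density of crux W3ᵐᵗ, implies logarithmic density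
  `≤ θ` by a layer-cake integration — not formalised here.)
* Reading (contrapositive, `κ₀⁻² = 81(7−4√3) = 5.8155`): at a Type-I blow-up with envelope rate `C₂`,
  for every `C₁ < 2.4115` the times at which the Galilean amplitude exceeds `C₁√ν/√(T−t)` have
  logarithmic final density at least `(5.8155 − C₁²)/(C₂² − C₁²)` — e.g. `≥ 36 %` for
  `(C₁, C₂) = (2, 3)`, `≥ 1.9 %` for `(2, 10)`. The sup-form rung is `θ = 0` / `E = ∅`.

WHAT THIS IS NOT: not the crux (no constraint when `C₁ ≥ 2.4115`); a re-packaging of the log-integral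
rung, no new analysis. [folklore]
-/

noncomputable section

open Set Filter Topology MeasureTheory
open scoped RealInnerProductSpace ENNReal NNReal Laplacian ContDiff
open Literature.Analysis.FluidPDE

namespace Summit.NavierStokesRegularity.NavierStokesRegularity.Theorems.DepletionLadder

-- the problem directory repeats the summit name (`NavierStokesRegularity/NavierStokesRegularity`)
set_option linter.dupNamespace false

open Summit.NavierStokesRegularity.NavierStokesRegularity.Theorems.RungReynoldsOne
open Summit.NavierStokesRegularity.NavierStokesRegularity.Theorems.DepletionLadder.StrainCube

/-- **THE MOST-TIMES (TWO-LEVEL) RUNG.** Let `u` be a classical solution of the unforced Navier–Stokes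
system on `ℝ³ × [0,T)` (`ν, T > 0`), Leray–Hopf from its rapidly decaying datum; let `0 ≤ t₁ < T`,
`0 < C₁ ≤ C₂`, `0 ≤ θ`, `0 ≤ B'` and a set `E ⊆ ℝ` of times (no measurability needed) be given with
* (envelope) for every `t ∈ [t₁,T) ∩ E` some constant vector `c` has `√(T−t)·|u(t,x) − c| ≤ C₂√ν` for
  all `x`;
* (good times) for every `t ∈ [t₁,T) \ E` some constant vector `c` has `√(T−t)·|u(t,x) − c| ≤ C₁√ν`
  for all `x`;
* (logarithmic final density of `E` at most `θ`) `∫_{(0,t)} 𝟙_E(s) ds/(T−s) ≤ B' + θ log(T/(T−t))`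
  for every `t ∈ (0,T)` (lower Lebesgue integral);
* `((2+√3)/9)² · (C₁² + θ(C₂² − C₁²)) < 1`.
Then `u` extends to a classical solution past `T`. Proof: the log-integral rung with the amplitude
`m(s)² = C₁²ν/(T−s) + 𝟙_E(s)(C₂² − C₁²)ν/(T−s)` after the onset `max t₁ (T/2)` and the Tao-cover bound
before it. [folklore] -/
theorem hasSmoothExtensionPast_of_twoLevelRate {ν T t₁ C₁ C₂ θ B' : ℝ} (hν : 0 < ν) (hT : 0 < T)
    (ht₁ : t₁ ∈ Ico 0 T) (hC₁ : 0 < C₁) (hC₁₂ : C₁ ≤ C₂) (hθ : 0 ≤ θ) (hB' : 0 ≤ B')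
    {E : Set ℝ}
    (hA1 : ((2 + Real.sqrt 3) / 9) ^ 2 * (C₁ ^ 2 + θ * (C₂ ^ 2 - C₁ ^ 2)) < 1)
    {u : ℝ → EuclideanSpace ℝ (Fin 3) → EuclideanSpace ℝ (Fin 3)}
    {p : ℝ → EuclideanSpace ℝ (Fin 3) → ℝ}
    (hsol : IsClassicalNSSolutionOn (Ico 0 T) ν 0 u p) (hLH : IsLerayHopfOn T ν 0 (u 0) u)
    (hdec : HasRapidSpatialDecay (u 0))
    (henv : ∀ t ∈ Ico t₁ T, t ∈ E → ∃ c : EuclideanSpace ℝ (Fin 3), ∀ x,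
      Real.sqrt (T - t) * ‖u t x - c‖ ≤ C₂ * Real.sqrt ν)
    (hgood : ∀ t ∈ Ico t₁ T, t ∉ E → ∃ c : EuclideanSpace ℝ (Fin 3), ∀ x,
      Real.sqrt (T - t) * ‖u t x - c‖ ≤ C₁ * Real.sqrt ν)
    (hdens : ∀ t ∈ Ioo 0 T, ∫⁻ s in Ioo 0 t, E.indicator (fun s => ENNReal.ofReal (1 / (T - s))) s ≤
      ENNReal.ofReal (B' + θ * Real.log (T / (T - t)))) :
    HasSmoothExtensionPast ν 0 u T := by
  classical
  -- the onset `t₀ = max t₁ (T/2) ∈ (0, T)`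
  set t₀ : ℝ := max t₁ (T / 2) with ht₀def
  have ht₀ : t₀ ∈ Ioo 0 T := ⟨lt_max_of_lt_right (by positivity), max_lt ht₁.2 (by linarith)⟩
  have ht₁₀ : t₁ ≤ t₀ := le_max_left _ _
  -- the rate at each late time: `C₂` on `E`, `C₁` off `E`
  have hrate : ∀ s ∈ Ico t₀ T, ∃ c : EuclideanSpace ℝ (Fin 3), ∀ x,
      Real.sqrt (T - s) * ‖u s x - c‖ ≤ (if s ∈ E then C₂ else C₁) * Real.sqrt ν := by
    intro s hs
    have hs' : s ∈ Ico t₁ T := ⟨ht₁₀.trans hs.1, hs.2⟩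
    by_cases h : s ∈ E
    · rw [if_pos h]; exact henv s hs' h
    · rw [if_neg h]; exact hgood s hs' h
  -- a sup bound on `[0, t₀]` from the Tao cover at `T' = t₀`
  obtain ⟨q₀, hsol₀, hu₀, -, -⟩ := stub_taoCover hν hT hsol hLH hdec ht₀
  obtain ⟨B₀, hB₀0, hB₀⟩ := exists_forall_norm_le_of_hasBoundedSobolevNormsOn hsol₀ hu₀
  -- the gauge and the amplitude
  set c : ℝ → EuclideanSpace ℝ (Fin 3) := fun s =>
    if h : s ∈ Ico t₀ T then Classical.choose (hrate s h) else 0 with hcdef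
  set R : ℝ → ℝ := fun s => if s ∈ E then C₂ else C₁ with hRdef
  set m : ℝ → ℝ := fun s =>
    if s ∈ Ico t₀ T then Real.sqrt (R s ^ 2 * ν / (T - s)) else B₀ with hmdef
  have hR0 : ∀ s, 0 ≤ R s := fun s => by
    rw [hRdef]; simp only; split_ifs <;> linarith
  have hRsq : ∀ s, R s ^ 2 ≤ C₁ ^ 2 + E.indicator (fun _ => C₂ ^ 2 - C₁ ^ 2) s := fun s => by
    rw [hRdef]; simp only
    by_cases h : s ∈ E
    · rw [if_pos h, indicator_of_mem h]; linarith
    · rw [if_neg h, indicator_of_notMem h]; linarith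
  have hC12 : 0 ≤ C₂ ^ 2 - C₁ ^ 2 := by nlinarith
  set A : ℝ := C₁ ^ 2 + θ * (C₂ ^ 2 - C₁ ^ 2) with hAdef
  have hA0 : 0 ≤ A := by positivity
  -- the amplitude dominates `|u − c|`
  have hm : ∀ s ∈ Ioo 0 T, ∀ x, ‖u s x - c s‖ ≤ m s := by
    intro s hs x
    by_cases h : s ∈ Ico t₀ T
    · have hspec := Classical.choose_spec (hrate s h) x
      have hc : c s = Classical.choose (hrate s h) := by rw [hcdef]; simp only [dif_pos h]
      have hm' : m s = Real.sqrt (R s ^ 2 * ν / (T - s)) := by rw [hmdef]; simp only [if_pos h]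
      rw [hc, hm']
      exact Real.le_sqrt_of_sq_le (sq_norm_le_of_rate_mul hν.le hs.2 hspec)
    · have hst : s < t₀ := by
        by_contra hle
        exact h ⟨not_lt.mp hle, hs.2⟩
      have hc : c s = 0 := by rw [hcdef]; simp only [dif_neg h]
      have hm' : m s = B₀ := by rw [hmdef]; simp only [if_neg h]
      rw [hc, hm', sub_zero]
      exact hB₀ s ⟨hs.1.le, hst.le⟩ x
  -- the log-integral bound with `A = C₁² + θ(C₂² − C₁²)`, `B = B₀²T + (C₂² − C₁²)ν B'`
  have hint : ∀ t ∈ Ioo 0 T, ∫⁻ s in Ioo 0 t, ENNReal.ofReal (m s ^ 2) ≤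
      ENNReal.ofReal ((B₀ ^ 2 * T + (C₂ ^ 2 - C₁ ^ 2) * ν * B') + A * ν * Real.log (T / (T - t))) := by
    intro t ht
    have hTt : 0 < T - t := sub_pos.2 ht.2
    have hlog : 0 ≤ Real.log (T / (T - t)) :=
      Real.log_nonneg ((one_le_div hTt).2 (by linarith [ht.1]))
    have hC1ν : 0 ≤ C₁ ^ 2 * ν := by positivity
    have hDν : 0 ≤ (C₂ ^ 2 - C₁ ^ 2) * ν := by positivity
    -- pointwise bound on `(0, t)`
    have hmsq : ∀ s ∈ Ioo 0 t, ENNReal.ofReal (m s ^ 2) ≤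
        ENNReal.ofReal (B₀ ^ 2) + ENNReal.ofReal (C₁ ^ 2 * ν / (T - s)) +
          ENNReal.ofReal ((C₂ ^ 2 - C₁ ^ 2) * ν) *
            E.indicator (fun s => ENNReal.ofReal (1 / (T - s))) s := by
      intro s hs
      have hTs : 0 < T - s := by linarith [hs.2, ht.2]
      by_cases h : s ∈ Ico t₀ T
      · have hm' : m s = Real.sqrt (R s ^ 2 * ν / (T - s)) := by rw [hmdef]; simp only [if_pos h]
        rw [hm', Real.sq_sqrt (by positivity)]
        by_cases hsE : s ∈ E
        · have hR : R s = C₂ := by rw [hRdef]; simp only [if_pos hsE]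
          rw [hR, indicator_of_mem hsE, ← ENNReal.ofReal_mul hDν,
            ← ENNReal.ofReal_add (by positivity) (by positivity),
            ← ENNReal.ofReal_add (by positivity) (by positivity)]
          refine ENNReal.ofReal_le_ofReal ?_
          rw [show C₂ ^ 2 * ν / (T - s) = C₁ ^ 2 * ν / (T - s) + (C₂ ^ 2 - C₁ ^ 2) * ν * (1 / (T - s)) by
            field_simp; ring]
          nlinarith [sq_nonneg B₀]
        · have hR : R s = C₁ := by rw [hRdef]; simp only [if_neg hsE]
          rw [hR, indicator_of_notMem hsE, mul_zero, add_zero,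
            ← ENNReal.ofReal_add (by positivity) (by positivity)]
          refine ENNReal.ofReal_le_ofReal ?_
          nlinarith [sq_nonneg B₀]
      · have hm' : m s = B₀ := by rw [hmdef]; simp only [if_neg h]
        rw [hm']
        calc ENNReal.ofReal (B₀ ^ 2) ≤ ENNReal.ofReal (B₀ ^ 2) + ENNReal.ofReal (C₁ ^ 2 * ν / (T - s)) :=
              le_self_add
          _ ≤ _ := le_self_add
    have hmeas1 : Measurable fun s : ℝ => ENNReal.ofReal (B₀ ^ 2) + ENNReal.ofReal (C₁ ^ 2 * ν / (T - s)) :=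
      measurable_const.add (ENNReal.measurable_ofReal.comp (measurable_const.div
        (measurable_const.sub measurable_id)))
    calc ∫⁻ s in Ioo 0 t, ENNReal.ofReal (m s ^ 2)
        ≤ ∫⁻ s in Ioo 0 t, (ENNReal.ofReal (B₀ ^ 2) + ENNReal.ofReal (C₁ ^ 2 * ν / (T - s)) +
            ENNReal.ofReal ((C₂ ^ 2 - C₁ ^ 2) * ν) *
              E.indicator (fun s => ENNReal.ofReal (1 / (T - s))) s) :=
          setLIntegral_mono' measurableSet_Ioo fun s hs => hmsq s hs
      _ = (∫⁻ s in Ioo 0 t, (ENNReal.ofReal (B₀ ^ 2) + ENNReal.ofReal (C₁ ^ 2 * ν / (T - s)))) +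
            ENNReal.ofReal ((C₂ ^ 2 - C₁ ^ 2) * ν) *
              ∫⁻ s in Ioo 0 t, E.indicator (fun s => ENNReal.ofReal (1 / (T - s))) s := by
          rw [lintegral_add_left hmeas1, lintegral_const_mul' _ _ ENNReal.ofReal_ne_top]
      _ = ENNReal.ofReal (B₀ ^ 2) * volume (Ioo 0 t) +
            (∫⁻ s in Ioo 0 t, ENNReal.ofReal (C₁ ^ 2 * ν / (T - s))) +
            ENNReal.ofReal ((C₂ ^ 2 - C₁ ^ 2) * ν) *
              ∫⁻ s in Ioo 0 t, E.indicator (fun s => ENNReal.ofReal (1 / (T - s))) s := by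
          rw [lintegral_add_left measurable_const, setLIntegral_const]
      _ ≤ ENNReal.ofReal (B₀ ^ 2 * T) + ENNReal.ofReal (C₁ ^ 2 * ν * Real.log (T / (T - t))) +
            ENNReal.ofReal ((C₂ ^ 2 - C₁ ^ 2) * ν) *
              ENNReal.ofReal (B' + θ * Real.log (T / (T - t))) := by
          gcongr
          · rw [Real.volume_Ioo, sub_zero, ← ENNReal.ofReal_mul (sq_nonneg _)]
            exact ENNReal.ofReal_le_ofReal (by nlinarith [sq_nonneg B₀, ht.2])
          · exact (lintegral_Ioo_div_sub_eq hC1ν ht.1.le ht.2).le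
          · exact hdens t ht
      _ = ENNReal.ofReal ((B₀ ^ 2 * T + (C₂ ^ 2 - C₁ ^ 2) * ν * B') +
            A * ν * Real.log (T / (T - t))) := by
          rw [← ENNReal.ofReal_mul hDν, ← ENNReal.ofReal_add (by positivity) (by positivity),
            ← ENNReal.ofReal_add (by positivity) (by positivity), hAdef]
          ring_nf
  exact hasSmoothExtensionPast_of_logIntegral_oscillation hν hT hA0 (by positivity) hA1 hsol hLH hdec
    hm hint

/-- **The most-times portrait of a Type-I blow-up** (contrapositive of the two-level rung). At a first
singular time `T` of a classical Leray–Hopf rapidly-decaying-datum solution with eventual Galilean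
envelope rate `C₂` (`√(T−t)·|u(t,x) − c_t| ≤ C₂√ν` from `t₁` on), for every `0 < C₁ ≤ C₂` and every
set `E` of times off which the Galilean rate is `≤ C₁` from `t₁` on, the logarithmic final
density of `E` is NOT below any `θ ≥ 0` with `((2+√3)/9)²(C₁² + θ(C₂² − C₁²)) < 1`: for every such
`θ` and every `B'` there is `t ∈ (0,T)` with `∫_{E∩(0,t)} ds/(T−s) > B' + θ log(T/(T−t))`. [folklore] -/
theorem exceptionalTimes_logDensity_of_not_hasSmoothExtensionPast {ν T t₁ C₁ C₂ θ B' : ℝ}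
    (hν : 0 < ν) (hT : 0 < T) (ht₁ : t₁ ∈ Ico 0 T) (hC₁ : 0 < C₁) (hC₁₂ : C₁ ≤ C₂) (hθ : 0 ≤ θ)
    (hB' : 0 ≤ B') {E : Set ℝ}
    (hA1 : ((2 + Real.sqrt 3) / 9) ^ 2 * (C₁ ^ 2 + θ * (C₂ ^ 2 - C₁ ^ 2)) < 1)
    {u : ℝ → EuclideanSpace ℝ (Fin 3) → EuclideanSpace ℝ (Fin 3)}
    {p : ℝ → EuclideanSpace ℝ (Fin 3) → ℝ}
    (hsol : IsClassicalNSSolutionOn (Ico 0 T) ν 0 u p) (hLH : IsLerayHopfOn T ν 0 (u 0) u)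
    (hdec : HasRapidSpatialDecay (u 0)) (hext : ¬ HasSmoothExtensionPast ν 0 u T)
    (henv : ∀ t ∈ Ico t₁ T, t ∈ E → ∃ c : EuclideanSpace ℝ (Fin 3), ∀ x,
      Real.sqrt (T - t) * ‖u t x - c‖ ≤ C₂ * Real.sqrt ν)
    (hgood : ∀ t ∈ Ico t₁ T, t ∉ E → ∃ c : EuclideanSpace ℝ (Fin 3), ∀ x,
      Real.sqrt (T - t) * ‖u t x - c‖ ≤ C₁ * Real.sqrt ν) :
    ∃ t ∈ Ioo 0 T, ENNReal.ofReal (B' + θ * Real.log (T / (T - t))) <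
      ∫⁻ s in Ioo 0 t, E.indicator (fun s => ENNReal.ofReal (1 / (T - s))) s := by
  by_contra h
  push Not at h
  exact hext (hasSmoothExtensionPast_of_twoLevelRate hν hT ht₁ hC₁ hC₁₂ hθ hB' hA1 hsol hLH hdec
    henv hgood h)

end Summit.NavierStokesRegularity.NavierStokesRegularity.Theorems.DepletionLadder

end
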